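import Literature.NumberTheory.Rogawski1990.FinExplicitTransferFactorColumnUnit          -- §A: `isUnit_finColumnFormValue_of_col_ne_zero`, `finKappaAt_eq_ite_finColumnFormValue`; ★ `…GHRegular`, ★ `…KappaEigenvector`
import Literature.NumberTheory.Automorphic.QuadraticLocalNormTestLocallyConstant        -- ★ units of `Π E_w` open ∕ embedded; the unit-norm test is locally constant on `σ`-fixed units
import HarnessLib

/-!
# Rogawski's explicit finite-place factor `Δ‴_v = τ_v · D_{G∕H,v} · κ_v` is CONTINUOUS on the `(G,H)`-regular matching locus, and its sign `κ_v`
# is LOCALLY CONSTANT there (the transfer-factor half of the descent datum «`Δ(γ_H δ_t, γ δ_t)` near a singular pair», Rogawski (1990) Prop. 8.1.3 p. 116)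

Topic `NumberTheory/Rogawski1990`; namespace `Literature.NumberTheory.Rogawski1990`.  THEOREMS ONLY (no definition, no named fact, no instance, no notation,
no `sorry`; net debt 0).  Cell `pub/hodgecm-mathlib`, F0∕P3a, topic T6 (#88 side, `SIZING-S1prime` §2 row (κ-loc) node D-G4 ∕ §7 «the explicit factor's
CONTINUITY at the singular pair … is NOT done»): the data facts a floor-1 proof of the singular κ-identity [Rogawski1990 Prop. 8.2.1 (a) ⇐ Prop. 8.1.3]
needs about ★ `finExplicitDelta` (typ-T6b N1f) near a `(G,H)`-REGULAR matching pair `ι_v(γ_H) ↔ γ′` — `χ_g(u)` a unit, `γ′` possibly `G`-SINGULAR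
(print's `γ₀ ∈ M`, `γ_H = (e₁·1₂, e₂)`, `χ_g(e₂) = (e₂ − e₁)² ≠ 0`).  Mathlib-only footing; count-neutral for the books.

THE MATHEMATICS.  (§3) `(γ_H, γ′) ↦ P_v = γ′² − tr(g)γ′ + det g` and `x_j = p_jᴴ H′_v p_j` are continuous (polynomials in the matrix entries; `σ = c ⊗ 1`
continuous ★ `continuous_conjLocal`); «column `j ≠ 0`» is an open condition; `x_j` is `σ`-fixed (`H′` hermitian, ★ `map_conjLocal_transpose_localForm`) and
a UNIT on the locus at non-split `v` (★ `isUnit_finColumnFormValue_of_col_ne_zero`), so ★ `eventually_normTest_iff_of_conjLocal_eq` [O'Meara 63:1b: local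
squares are open] makes the unit-norm test of `x_j` — hence `κ_v`, read on the column `j` by ★ `finKappaAt_eq_ite_finColumnFormValue` — constant near the
pair among matching pairs (`finKappaAt_eventually_eq`); at a split `v`, `κ_v = +1` identically where `P_v ≠ 0` (★ `finKappaAt_of_not_subsingleton`).
(§4) `τ_v(γ_H) = μ_v(u) μ_v(−χ_g(u)∕det g)⁻¹` is continuous where `χ_g(u)` is a unit — `μ_v` = ★ `finHeckeValue` agrees with the continuous ★
`semilocalComponent` (★ `continuous_semilocalComponent`) on the OPEN, EMBEDDED unit group of `E_v` (★ `continuousAt_of_eq_apply_unit`), and both its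
arguments are units there (★ `isUnit_finGammaTwo`, ★ `isUnit_finTauArg_of_isUnit`); `D_{G∕H,v} = (Π_w ‖χ_g(u)_w‖_w)^{1∕2}` is continuous everywhere.
(§5) HEAD: on `{ι_v(γ_H) ↔ γ′ ∧ χ_g(u) unit}` the factor is `τ_v · D · κ_v` (★ `finExplicitDelta_of_isLocalNormPair`), a product of functions continuous
there — at EVERY finite `v`, every hermitian `H′` with `det H′ ≠ 0`, every Hecke character `μ`.

* §3 `continuous_fst_localMatrix`, `continuous_localMatrix`, `continuous_finGammaTwo`, `continuous_finEigenlineProjector`, `continuous_finColumnFormValue`,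
  `conjLocal_finColumnFormValue`, **`finKappaAt_eventually_eq`**, `continuousOn_finKappaAt`.
* §4 `continuous_eval_finCharpolyTwo`, `continuousAt_finHeckeValue`, `continuous_finTauArg`, **`continuousOn_finTau`**, `continuous_finWeylRatio`.
* §5 HEAD **`continuousOn_finExplicitDelta`**.

HONEST LABEL: HC_CM is proved only modulo the printed citations (named inputs remaining 2) until rung 0 closes; this file proves none of them — it is the
continuity bookkeeping of print's explicit factor, one input of the (κ-loc) letter of `S1′` (`stub_tamagawaSingularMembers_exist`), not that letter; the
orbital-integral side of the descent (germs) is untouched.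

## References
* [Rogawski1990] J. D. Rogawski, *Automorphic Representations of Unitary Groups in Three Variables*, Ann. of Math. Stud. 123 (1990): §4.9 p. 55 (`τ`, `D_{G∕H}`,
  `Δ_{G∕H}`), §4.3 p. 43, §3.5 Prop. 3.5.2 (c) p. 29, Prop. 8.1.3 and its proof pp. 115–116 (the transfer factor along `γ_H δ_t → γ_H`), Prop. 8.2.1 (a)
  p. 118, §14.6 p. 242 («`κ(γ, ψ_v(i(γ)))` is equal to `±1`»).
* [LanglandsShelstad1987] R. P. Langlands, D. Shelstad, *On the definition of transfer factors*, Math. Ann. 278 (1987), §1–§2, Lemma 4.1.A (transfer factors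
  are locally constant on the strongly `G`-regular set).
* [Omeara1963] O. T. O'Meara, *Introduction to Quadratic Forms* (1963), §63A Cor. 63:1b (local squares are open).
* [TateThesis1967] J. Tate, *Fourier analysis in number fields and Hecke's zeta-functions* (1950∕1967), §4.3 (local components of idèle-class characters).
-/

set_option autoImplicit false

noncomputable section

open NumberField IsDedekindDomain Matrix Polynomial Filter Topology
open scoped MatrixGroups

namespace Literature.NumberTheory.Rogawski1990

open Literature.NumberTheory.Automorphic
open Literature.NumberTheory.GaloisRepresentations
open Literature.NumberTheory.GelbartRogawski1991.UnitaryDualPair (imagUnit complexConj_imagUnit imagUnit_ne_zero)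

/-! ## §3 Continuity of `P_v`, `x_j`; local constancy of `κ_v` on the `(G,H)`-regular matching locus -/

section KappaLocallyConstant

variable (L : Type) [Field L] [NumberField L] [IsCMField L] (v : HeightOneSpectrum (𝓞 ↥(maximalRealSubfield L)))
  (H' : Matrix (Fin 3) (Fin 3) L)

/-- `γ_H ↦ g` (the `U(Φ₂)`-block, as a matrix over `E_v`) is continuous. [cite: Rogawski1990, §4.9 p. 55] -/
theorem continuous_fst_localMatrix :
    Continuous fun a : (UnitaryGroup.cmDatum L 2 (Matrix.of fun i j : Fin 2 => if i.val + j.val + 1 = 2 then (1 : L) else 0)).Local v ×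
        (UnitaryGroup.cmDatum L 1 (Matrix.of fun i j : Fin 1 => if i.val + j.val + 1 = 1 then (1 : L) else 0)).Local v =>
      (a.1.val.val : Matrix (Fin 2) (Fin 2) (UnitaryGroup.LocalRing L v)) :=
  Units.continuous_val.comp (continuous_subtype_val.comp continuous_fst)

/-- `γ′ ↦ γ′` (as a matrix over `E_v`) is continuous. [cite: Rogawski1990, §4.9 p. 55] -/
theorem continuous_localMatrix :
    Continuous fun b : (UnitaryGroup.cmDatum L 3 H').Local v => (b.val.val : Matrix (Fin 3) (Fin 3) (UnitaryGroup.LocalRing L v)) :=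
  Units.continuous_val.comp continuous_subtype_val

/-- **`u = γ₂` is continuous in `γ_H`.** [cite: Rogawski1990, §4.9 p. 55] -/
theorem continuous_finGammaTwo :
    Continuous fun a : (UnitaryGroup.cmDatum L 2 (Matrix.of fun i j : Fin 2 => if i.val + j.val + 1 = 2 then (1 : L) else 0)).Local v ×
        (UnitaryGroup.cmDatum L 1 (Matrix.of fun i j : Fin 1 => if i.val + j.val + 1 = 1 then (1 : L) else 0)).Local v =>
      finGammaTwo L v a := by
  have h1 : Continuous fun a : (UnitaryGroup.cmDatum L 2 (Matrix.of fun i j : Fin 2 => if i.val + j.val + 1 = 2 then (1 : L) else 0)).Local v ×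
        (UnitaryGroup.cmDatum L 1 (Matrix.of fun i j : Fin 1 => if i.val + j.val + 1 = 1 then (1 : L) else 0)).Local v =>
      (a.2.val.val : Matrix (Fin 1) (Fin 1) (UnitaryGroup.LocalRing L v)) :=
    Units.continuous_val.comp (continuous_subtype_val.comp continuous_snd)
  exact (continuous_apply 0).comp ((continuous_apply 0).comp h1)

/-- **`P_v(γ_H, γ′) = γ′² − tr(g) γ′ + det(g)` is continuous in `(γ_H, γ′)`.** [cite: Rogawski1990, §4.9 p. 55] -/
theorem continuous_finEigenlineProjector :
    Continuous fun q : ((UnitaryGroup.cmDatum L 2 (Matrix.of fun i j : Fin 2 => if i.val + j.val + 1 = 2 then (1 : L) else 0)).Local v ×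
        (UnitaryGroup.cmDatum L 1 (Matrix.of fun i j : Fin 1 => if i.val + j.val + 1 = 1 then (1 : L) else 0)).Local v) ×
        (UnitaryGroup.cmDatum L 3 H').Local v => finEigenlineProjector L v H' q.1 q.2 := by
  have hg := (continuous_fst_localMatrix L v).comp
    (continuous_fst : Continuous fun q : ((UnitaryGroup.cmDatum L 2 (Matrix.of fun i j : Fin 2 => if i.val + j.val + 1 = 2 then (1 : L) else 0)).Local v ×
        (UnitaryGroup.cmDatum L 1 (Matrix.of fun i j : Fin 1 => if i.val + j.val + 1 = 1 then (1 : L) else 0)).Local v) ×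
        (UnitaryGroup.cmDatum L 3 H').Local v => q.1)
  have hx := (continuous_localMatrix L v H').comp
    (continuous_snd : Continuous fun q : ((UnitaryGroup.cmDatum L 2 (Matrix.of fun i j : Fin 2 => if i.val + j.val + 1 = 2 then (1 : L) else 0)).Local v ×
        (UnitaryGroup.cmDatum L 1 (Matrix.of fun i j : Fin 1 => if i.val + j.val + 1 = 1 then (1 : L) else 0)).Local v) ×
        (UnitaryGroup.cmDatum L 3 H').Local v => q.2)
  dsimp only [finEigenlineProjector]
  exact ((hx.mul hx).sub ((hg.matrix_trace).smul hx)).add ((hg.matrix_det).smul continuous_const)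

/-- **`x_j(γ_H, γ′) = p_jᴴ H′_v p_j` is continuous in `(γ_H, γ′)`** (`σ = c ⊗ 1` is continuous, ★ `continuous_conjLocal`). [cite: Rogawski1990, §3.5 Prop. 3.5.2 (c) p. 29] -/
theorem continuous_finColumnFormValue (j : Fin 3) :
    Continuous fun q : ((UnitaryGroup.cmDatum L 2 (Matrix.of fun i j : Fin 2 => if i.val + j.val + 1 = 2 then (1 : L) else 0)).Local v ×
        (UnitaryGroup.cmDatum L 1 (Matrix.of fun i j : Fin 1 => if i.val + j.val + 1 = 1 then (1 : L) else 0)).Local v) ×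
        (UnitaryGroup.cmDatum L 3 H').Local v => finColumnFormValue L v H' q.1 q.2 j := by
  have hP := continuous_finEigenlineProjector L v H'
  have hσ := UnitaryGroup.continuous_conjLocal L (IsCMField.complexConj L) v
  unfold finColumnFormValue
  refine continuous_finsetSum _ fun i _ => continuous_finsetSum _ fun k _ => ?_
  exact ((hσ.comp (hP.matrix_elem i j)).mul continuous_const).mul (hP.matrix_elem k j)

/-- **`x_j` is `σ`-fixed** when `H′` is hermitian (`σ(H′_v)ᵀ = H′_v`, ★ `map_conjLocal_transpose_localForm`; `σ ∘ σ = id`). [cite: Rogawski1990, §3.5 Prop. 3.5.2 (c) p. 29] -/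
theorem conjLocal_finColumnFormValue (hH : (H'.map (cmConjRingHom L))ᵀ = H')
    (a : (UnitaryGroup.cmDatum L 2 (Matrix.of fun i j : Fin 2 => if i.val + j.val + 1 = 2 then (1 : L) else 0)).Local v ×
      (UnitaryGroup.cmDatum L 1 (Matrix.of fun i j : Fin 1 => if i.val + j.val + 1 = 1 then (1 : L) else 0)).Local v)
    (γ' : (UnitaryGroup.cmDatum L 3 H').Local v) (j : Fin 3) :
    UnitaryGroup.conjLocal L (IsCMField.complexConj L) v (finColumnFormValue L v H' a γ' j) = finColumnFormValue L v H' a γ' j := by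
  have hHerm := UnitaryGroup.map_conjLocal_transpose_localForm L 3 H' v hH
  have hik : ∀ i k : Fin 3, UnitaryGroup.conjLocal L (IsCMField.complexConj L) v
      (((UnitaryGroup.adelicForm L 3 H').map (UnitaryGroup.adeleToLocal L v)) i k) =
      ((UnitaryGroup.adelicForm L 3 H').map (UnitaryGroup.adeleToLocal L v)) k i := fun i k => by
    have hki := congrFun (congrFun hHerm k) i
    rw [transpose_apply, map_apply] at hki
    exact hki
  have hσσ : ∀ x, UnitaryGroup.conjLocal L (IsCMField.complexConj L) v (UnitaryGroup.conjLocal L (IsCMField.complexConj L) v x) = x :=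
    UnitaryGroup.conjLocal_conjLocal (IsCMField.complexConj L) v (complexConj_imagUnit L) (imagUnit_ne_zero L)
  unfold finColumnFormValue
  simp only [map_sum, map_mul, hσσ, hik]
  rw [Finset.sum_comm]
  refine Finset.sum_congr rfl fun k _ => Finset.sum_congr rfl fun i _ => ?_
  ring

open scoped Classical in
/-- **THE SIGN `κ_v` IS LOCALLY CONSTANT ON THE `(G,H)`-REGULAR MATCHING LOCUS** — every finite `v`, every hermitian `H′` with `det H′ ≠ 0`: at a matching
pair `ι_v(γ_H) ↔ γ′` with `χ_g(u)` a unit (`γ′` may be `G`-singular), every nearby MATCHING pair `(γ_H¹, γ′¹)` has `κ_v(γ_H¹, γ′¹) = κ_v(γ_H, γ′)`.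
Split `v`: both are `+1` (★ `finKappaAt_of_not_subsingleton`; `P_v ≠ 0` persists nearby).  Non-split `v`: read `κ_v` on a column `p_j ≠ 0` of `P_v`
(§2), which stays non-zero nearby; `x_j` is a `σ`-fixed unit (§1) depending continuously on the pair, and the unit-norm test is locally constant on the
`σ`-fixed units (F1 ★ `eventually_normTest_iff_of_conjLocal_eq`, O'Meara 63:1b).  Print: the transfer factor is locally constant near the `(G,H)`-regular
pair `(γ_H, γ₀)` along `γ_H δ_t` [Prop. 8.1.3 proof]. [cite: Rogawski1990, Prop. 8.1.3 proof pp. 115–116; §14.6 p. 242; §4.3 p. 43] [cite: LanglandsShelstad1987, Lemma 4.1.A] [cite: Omeara1963, §63A Cor. 63:1b] -/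
theorem finKappaAt_eventually_eq (hH : (H'.map (cmConjRingHom L))ᵀ = H') (hdet : H'.det ≠ 0)
    {a₀ : (UnitaryGroup.cmDatum L 2 (Matrix.of fun i j : Fin 2 => if i.val + j.val + 1 = 2 then (1 : L) else 0)).Local v ×
      (UnitaryGroup.cmDatum L 1 (Matrix.of fun i j : Fin 1 => if i.val + j.val + 1 = 1 then (1 : L) else 0)).Local v}
    {b₀ : (UnitaryGroup.cmDatum L 3 H').Local v} (h₀ : IsLocalNormPair L H' v a₀ b₀)
    (hu₀ : IsUnit ((finCharpolyTwo L v a₀).eval (finGammaTwo L v a₀))) :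
    ∀ᶠ q in 𝓝 (a₀, b₀), IsLocalNormPair L H' v q.1 q.2 → finKappaAt L v H' q.1 q.2 = finKappaAt L v H' a₀ b₀ := by
  haveI : Algebra.IsQuadraticExtension ↥(maximalRealSubfield L) L := IsCMField.isQuadraticExtension L
  have hP₀ : finEigenlineProjector L v H' a₀ b₀ ≠ 0 := finEigenlineProjector_ne_zero_of_isUnit L v H' a₀ b₀ h₀ hu₀
  -- a non-zero column `j` of `P_v(γ_H, γ′)`
  obtain ⟨j, hj⟩ : ∃ j : Fin 3, (fun i => finEigenlineProjector L v H' a₀ b₀ i j) ≠ 0 := by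
    by_contra hcon
    push Not at hcon
    exact hP₀ (Matrix.ext fun i j => by simpa using congrFun (hcon j) i)
  -- the column stays non-zero nearby
  have hcolcont : Continuous fun q : ((UnitaryGroup.cmDatum L 2 (Matrix.of fun i j : Fin 2 => if i.val + j.val + 1 = 2 then (1 : L) else 0)).Local v ×
        (UnitaryGroup.cmDatum L 1 (Matrix.of fun i j : Fin 1 => if i.val + j.val + 1 = 1 then (1 : L) else 0)).Local v) ×
        (UnitaryGroup.cmDatum L 3 H').Local v => fun i => finEigenlineProjector L v H' q.1 q.2 i j :=
    continuous_pi fun i => (continuous_finEigenlineProjector L v H').matrix_elem i j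
  have hcolne : ∀ᶠ q in 𝓝 (a₀, b₀), (fun i => finEigenlineProjector L v H' q.1 q.2 i j) ≠ 0 :=
    hcolcont.continuousAt.eventually_ne hj
  by_cases hv : Subsingleton (UnitaryGroup.PlacesOver L v)
  · -- non-split: read on the column `j`
    have hx₀u : IsUnit (finColumnFormValue L v H' a₀ b₀ j) := isUnit_finColumnFormValue_of_col_ne_zero L v H' a₀ b₀ hv hdet h₀ hu₀ hj
    have hx₀fix := conjLocal_finColumnFormValue L v H' hH a₀ b₀ j
    have hxcont := (continuous_finColumnFormValue L v H' j).continuousAt (x := (a₀, b₀))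
    have htest := hxcont.eventually
      (UnitaryGroup.eventually_normTest_iff_of_conjLocal_eq L v (IsCMField.complexConj L) (complexConj_imagUnit L) (imagUnit_ne_zero L) hx₀fix hx₀u)
    -- `χ_g(u)` stays a unit nearby (units are open)
    have hχcont : Continuous fun q : ((UnitaryGroup.cmDatum L 2 (Matrix.of fun i j : Fin 2 => if i.val + j.val + 1 = 2 then (1 : L) else 0)).Local v ×
        (UnitaryGroup.cmDatum L 1 (Matrix.of fun i j : Fin 1 => if i.val + j.val + 1 = 1 then (1 : L) else 0)).Local v) ×
        (UnitaryGroup.cmDatum L 3 H').Local v => (finCharpolyTwo L v q.1).eval (finGammaTwo L v q.1) := by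
      have hg := (continuous_fst_localMatrix L v).comp
        (continuous_fst : Continuous fun q : ((UnitaryGroup.cmDatum L 2 (Matrix.of fun i j : Fin 2 => if i.val + j.val + 1 = 2 then (1 : L) else 0)).Local v ×
          (UnitaryGroup.cmDatum L 1 (Matrix.of fun i j : Fin 1 => if i.val + j.val + 1 = 1 then (1 : L) else 0)).Local v) ×
          (UnitaryGroup.cmDatum L 3 H').Local v => q.1)
      have hu := (continuous_finGammaTwo L v).comp
        (continuous_fst : Continuous fun q : ((UnitaryGroup.cmDatum L 2 (Matrix.of fun i j : Fin 2 => if i.val + j.val + 1 = 2 then (1 : L) else 0)).Local v ×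
          (UnitaryGroup.cmDatum L 1 (Matrix.of fun i j : Fin 1 => if i.val + j.val + 1 = 1 then (1 : L) else 0)).Local v) ×
          (UnitaryGroup.cmDatum L 3 H').Local v => q.1)
      simp_rw [eval_finCharpolyTwo_finGammaTwo]
      exact ((hu.mul hu).sub (hg.matrix_trace.mul hu)).add hg.matrix_det
    have hχunit : ∀ᶠ q : ((UnitaryGroup.cmDatum L 2 (Matrix.of fun i j : Fin 2 => if i.val + j.val + 1 = 2 then (1 : L) else 0)).Local v ×
        (UnitaryGroup.cmDatum L 1 (Matrix.of fun i j : Fin 1 => if i.val + j.val + 1 = 1 then (1 : L) else 0)).Local v) ×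
        (UnitaryGroup.cmDatum L 3 H').Local v in 𝓝 (a₀, b₀), IsUnit ((finCharpolyTwo L v q.1).eval (finGammaTwo L v q.1)) :=
      hχcont.continuousAt.eventually ((UnitaryGroup.isOpen_setOf_isUnit_localRing L v).mem_nhds hu₀)
    filter_upwards [hcolne, htest, hχunit] with q hq hqtest hqu hmatch
    rw [finKappaAt_eq_ite_finColumnFormValue L v H' q.1 q.2 hv hmatch hqu hq,
      finKappaAt_eq_ite_finColumnFormValue L v H' a₀ b₀ hv h₀ hu₀ hj]
    have hiff := hqtest (conjLocal_finColumnFormValue L v H' hH q.1 q.2 j)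
    by_cases hc : ∃ z : UnitaryGroup.LocalRing L v, IsUnit z ∧
        finColumnFormValue L v H' a₀ b₀ j = z * UnitaryGroup.conjLocal L (IsCMField.complexConj L) v z
    · rw [if_pos hc, if_pos (hiff.2 hc)]
    · rw [if_neg hc, if_neg (fun h' => hc (hiff.1 h'))]
  · -- split: `κ_v = +1` wherever the column is non-zero
    filter_upwards [hcolne] with q hq hmatch
    have hPq : finEigenlineProjector L v H' q.1 q.2 ≠ 0 := fun h0 => hq (funext fun i => by rw [h0]; rfl)
    rw [finKappaAt_of_not_subsingleton L v H' q.1 hPq hv, finKappaAt_of_not_subsingleton L v H' a₀ hP₀ hv]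

/-- **`κ_v` is continuous (= locally constant, `ℤ` discrete) on the `(G,H)`-regular matching locus** `{(γ_H, γ′) : ι_v(γ_H) ↔ γ′, χ_g(u) ∈ E_v^×}`.
[cite: Rogawski1990, Prop. 8.1.3 proof pp. 115–116; §14.6 p. 242] [cite: LanglandsShelstad1987, Lemma 4.1.A] -/
theorem continuousOn_finKappaAt (hH : (H'.map (cmConjRingHom L))ᵀ = H') (hdet : H'.det ≠ 0) :
    ContinuousOn
      (fun q : ((UnitaryGroup.cmDatum L 2 (Matrix.of fun i j : Fin 2 => if i.val + j.val + 1 = 2 then (1 : L) else 0)).Local v ×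
        (UnitaryGroup.cmDatum L 1 (Matrix.of fun i j : Fin 1 => if i.val + j.val + 1 = 1 then (1 : L) else 0)).Local v) ×
        (UnitaryGroup.cmDatum L 3 H').Local v => finKappaAt L v H' q.1 q.2)
      {q | IsLocalNormPair L H' v q.1 q.2 ∧ IsUnit ((finCharpolyTwo L v q.1).eval (finGammaTwo L v q.1))} := by
  rintro ⟨a₀, b₀⟩ ⟨h₀, hu₀⟩
  have hev := finKappaAt_eventually_eq L v H' hH hdet h₀ hu₀
  refine (continuousWithinAt_const (b := finKappaAt L v H' a₀ b₀)).congr_of_eventuallyEq ?_ rfl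
  rw [eventuallyEq_nhdsWithin_iff]
  filter_upwards [hev] with q hq hmem
  exact hq hmem.1

end KappaLocallyConstant

/-! ## §4 Continuity of `τ_v` (where `χ_g(u)` is a unit) and of `D_{G∕H,v}` -/

section TauWeyl

variable (L : Type) [Field L] [NumberField L] [IsCMField L] (v : HeightOneSpectrum (𝓞 ↥(maximalRealSubfield L)))

/-- **`χ_g(u)` is continuous in `γ_H`** (`= u² − tr(g) u + det g`, ★ `eval_finCharpolyTwo_finGammaTwo`). [cite: Rogawski1990, §4.9 p. 55] -/
theorem continuous_eval_finCharpolyTwo :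
    Continuous fun a : (UnitaryGroup.cmDatum L 2 (Matrix.of fun i j : Fin 2 => if i.val + j.val + 1 = 2 then (1 : L) else 0)).Local v ×
        (UnitaryGroup.cmDatum L 1 (Matrix.of fun i j : Fin 1 => if i.val + j.val + 1 = 1 then (1 : L) else 0)).Local v =>
      (finCharpolyTwo L v a).eval (finGammaTwo L v a) := by
  have hg := continuous_fst_localMatrix L v
  have hu := continuous_finGammaTwo L v
  simp_rw [eval_finCharpolyTwo_finGammaTwo]
  exact ((hu.mul hu).sub (hg.matrix_trace.mul hu)).add hg.matrix_det

omit [IsCMField L] in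
/-- **`μ_v` is continuous at every unit** of `E_v`: there it is the continuous ★ `HeckeCharacter.semilocalComponent` on the open, embedded unit group (F1 ★
`continuousAt_of_eq_apply_unit`). [cite: Rogawski1990, §4.9 p. 55] [cite: TateThesis1967, §4.3] -/
theorem continuousAt_finHeckeValue (μ : HeckeCharacter L) {x : UnitaryGroup.LocalRing L v} (hx : IsUnit x) :
    ContinuousAt (finHeckeValue L v μ) x :=
  UnitaryGroup.continuousAt_of_eq_apply_unit L v
    (g := fun u : (UnitaryGroup.LocalRing L v)ˣ => ((μ.semilocalComponent L v u : ℂˣ) : ℂ))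
    (Units.continuous_val.comp (UnitaryGroup.continuous_semilocalComponent L μ))
    (fun _ hy => finHeckeValue_of_isUnit L v μ hy) hx

/-- **`−χ_g(u)·det g⁻¹` is continuous in `γ_H`.** [cite: Rogawski1990, §4.9 p. 55] -/
theorem continuous_finTauArg :
    Continuous fun a : (UnitaryGroup.cmDatum L 2 (Matrix.of fun i j : Fin 2 => if i.val + j.val + 1 = 2 then (1 : L) else 0)).Local v ×
        (UnitaryGroup.cmDatum L 1 (Matrix.of fun i j : Fin 1 => if i.val + j.val + 1 = 1 then (1 : L) else 0)).Local v =>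
      finTauArg L v a := by
  have hinv : Continuous fun a : (UnitaryGroup.cmDatum L 2 (Matrix.of fun i j : Fin 2 => if i.val + j.val + 1 = 2 then (1 : L) else 0)).Local v ×
        (UnitaryGroup.cmDatum L 1 (Matrix.of fun i j : Fin 1 => if i.val + j.val + 1 = 1 then (1 : L) else 0)).Local v =>
      ((a.1.val⁻¹).val : Matrix (Fin 2) (Fin 2) (UnitaryGroup.LocalRing L v)) :=
    Units.continuous_coe_inv.comp (continuous_subtype_val.comp continuous_fst)
  unfold finTauArg
  exact (continuous_eval_finCharpolyTwo L v).neg.mul hinv.matrix_det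

/-- **`τ_v(γ_H) = μ_v(u) · μ_v(−χ_g(u)∕det g)⁻¹` IS CONTINUOUS ON `{χ_g(u) ∈ E_v^×}`** (both arguments of `μ_v` are units there: ★ `isUnit_finGammaTwo`, ★
`isUnit_finTauArg_of_isUnit`; `μ_v ≠ 0` at units, ★ `finHeckeValue_ne_zero_of_isUnit`). [cite: Rogawski1990, §4.9 p. 55] -/
theorem continuousOn_finTau (μ : HeckeCharacter L) :
    ContinuousOn
      (fun a : (UnitaryGroup.cmDatum L 2 (Matrix.of fun i j : Fin 2 => if i.val + j.val + 1 = 2 then (1 : L) else 0)).Local v ×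
        (UnitaryGroup.cmDatum L 1 (Matrix.of fun i j : Fin 1 => if i.val + j.val + 1 = 1 then (1 : L) else 0)).Local v => finTau L v a μ)
      {a | IsUnit ((finCharpolyTwo L v a).eval (finGammaTwo L v a))} := by
  intro a ha
  rw [Set.mem_setOf_eq] at ha
  refine ContinuousAt.continuousWithinAt ?_
  unfold finTau
  have h1 : ContinuousAt (fun a' : (UnitaryGroup.cmDatum L 2 (Matrix.of fun i j : Fin 2 => if i.val + j.val + 1 = 2 then (1 : L) else 0)).Local v ×
        (UnitaryGroup.cmDatum L 1 (Matrix.of fun i j : Fin 1 => if i.val + j.val + 1 = 1 then (1 : L) else 0)).Local v =>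
      finHeckeValue L v μ (finGammaTwo L v a')) a :=
    (continuousAt_finHeckeValue L v μ (isUnit_finGammaTwo L v a)).comp (continuous_finGammaTwo L v).continuousAt
  have h2 : ContinuousAt (fun a' : (UnitaryGroup.cmDatum L 2 (Matrix.of fun i j : Fin 2 => if i.val + j.val + 1 = 2 then (1 : L) else 0)).Local v ×
        (UnitaryGroup.cmDatum L 1 (Matrix.of fun i j : Fin 1 => if i.val + j.val + 1 = 1 then (1 : L) else 0)).Local v =>
      finHeckeValue L v μ (finTauArg L v a')) a :=
    (continuousAt_finHeckeValue L v μ (isUnit_finTauArg_of_isUnit L v a ha)).comp (continuous_finTauArg L v).continuousAt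
  exact h1.mul (h2.inv₀ (finHeckeValue_ne_zero_of_isUnit L v μ (isUnit_finTauArg_of_isUnit L v a ha)))

/-- **`D_{G∕H,v}(γ_H) = (Π_{w∣v} ‖χ_g(u)_w‖_w)^{1∕2}` IS CONTINUOUS** in `γ_H` (everywhere). [cite: Rogawski1990, §4.9 p. 55] -/
theorem continuous_finWeylRatio :
    Continuous fun a : (UnitaryGroup.cmDatum L 2 (Matrix.of fun i j : Fin 2 => if i.val + j.val + 1 = 2 then (1 : L) else 0)).Local v ×
        (UnitaryGroup.cmDatum L 1 (Matrix.of fun i j : Fin 1 => if i.val + j.val + 1 = 1 then (1 : L) else 0)).Local v =>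
      finWeylRatio L v a := by
  unfold finWeylRatio
  refine Real.continuous_sqrt.comp (continuous_finsetProd _ fun w _ => ?_)
  exact continuous_norm.comp ((continuous_apply w).comp (continuous_eval_finCharpolyTwo L v))

end TauWeyl

/-! ## §5 HEAD: `Δ‴_v` is continuous on the `(G,H)`-regular matching locus -/

section Head

variable (L : Type) [Field L] [NumberField L] [IsCMField L] (v : HeightOneSpectrum (𝓞 ↥(maximalRealSubfield L)))
  (H' : Matrix (Fin 3) (Fin 3) L)

open scoped Classical in
/-- **ROGAWSKI'S EXPLICIT FINITE-PLACE FACTOR `Δ‴_v = τ_v · D_{G∕H,v} · κ_v` IS CONTINUOUS ON THE `(G,H)`-REGULAR MATCHING LOCUS** — at EVERY finite place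
`v` of `L⁺`, for every hermitian `H′` with `det H′ ≠ 0` and every Hecke character `μ`: the map `(γ_H, γ′) ↦ Δ‴_v(γ_H, γ′)` (★ `finExplicitDelta`) is
continuous on `{(γ_H, γ′) : ι_v(γ_H) ↔ γ′ ∧ χ_g(u) ∈ E_v^×}` ⊂ H_v × G′_v — the locus contains the `G`-SINGULAR matching pairs over print's `γ₀ ∈ M`
(`γ_H = (e₁·1₂, e₂)`, `χ_g(e₂) = (e₂ − e₁)² ≠ 0`).  There `Δ‴_v = τ_v D κ_v` (★ `finExplicitDelta_of_isLocalNormPair`) with `τ_v`, `D` continuous (§4) and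
`κ_v` locally constant (§3).  This is the transfer-factor input of the descent «`Δ(γ_H δ_t, γ δ_t) → Δ_{G∕H}(γ₀)`, `t → 0`» in the proof of the singular
κ-identity [Prop. 8.2.1 (a) ⇐ Prop. 8.1.3]; it does NOT address the orbital-integral side (germs), which stays the (κ-loc) letter of `S1′`.
[cite: Rogawski1990, Prop. 8.1.3 proof pp. 115–116; Prop. 8.2.1 (a) p. 118; §4.9 p. 55; §14.6 p. 242] [cite: LanglandsShelstad1987, Lemma 4.1.A] -/
theorem continuousOn_finExplicitDelta (hH : (H'.map (cmConjRingHom L))ᵀ = H') (hdet : H'.det ≠ 0) (μ : HeckeCharacter L) :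
    ContinuousOn
      (fun q : ((UnitaryGroup.cmDatum L 2 (Matrix.of fun i j : Fin 2 => if i.val + j.val + 1 = 2 then (1 : L) else 0)).Local v ×
        (UnitaryGroup.cmDatum L 1 (Matrix.of fun i j : Fin 1 => if i.val + j.val + 1 = 1 then (1 : L) else 0)).Local v) ×
        (UnitaryGroup.cmDatum L 3 H').Local v => finExplicitDelta L v H' q.1 μ q.2)
      {q | IsLocalNormPair L H' v q.1 q.2 ∧ IsUnit ((finCharpolyTwo L v q.1).eval (finGammaTwo L v q.1))} := by
  have hτ : ContinuousOn
      (fun q : ((UnitaryGroup.cmDatum L 2 (Matrix.of fun i j : Fin 2 => if i.val + j.val + 1 = 2 then (1 : L) else 0)).Local v ×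
        (UnitaryGroup.cmDatum L 1 (Matrix.of fun i j : Fin 1 => if i.val + j.val + 1 = 1 then (1 : L) else 0)).Local v) ×
        (UnitaryGroup.cmDatum L 3 H').Local v => finTau L v q.1 μ)
      {q | IsLocalNormPair L H' v q.1 q.2 ∧ IsUnit ((finCharpolyTwo L v q.1).eval (finGammaTwo L v q.1))} :=
    (continuousOn_finTau L v μ).comp continuous_fst.continuousOn fun q hq => hq.2
  have hD : ContinuousOn
      (fun q : ((UnitaryGroup.cmDatum L 2 (Matrix.of fun i j : Fin 2 => if i.val + j.val + 1 = 2 then (1 : L) else 0)).Local v ×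
        (UnitaryGroup.cmDatum L 1 (Matrix.of fun i j : Fin 1 => if i.val + j.val + 1 = 1 then (1 : L) else 0)).Local v) ×
        (UnitaryGroup.cmDatum L 3 H').Local v => (finWeylRatio L v q.1 : ℂ))
      {q | IsLocalNormPair L H' v q.1 q.2 ∧ IsUnit ((finCharpolyTwo L v q.1).eval (finGammaTwo L v q.1))} :=
    (Complex.continuous_ofReal.comp ((continuous_finWeylRatio L v).comp continuous_fst)).continuousOn
  have hκ : ContinuousOn
      (fun q : ((UnitaryGroup.cmDatum L 2 (Matrix.of fun i j : Fin 2 => if i.val + j.val + 1 = 2 then (1 : L) else 0)).Local v ×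
        (UnitaryGroup.cmDatum L 1 (Matrix.of fun i j : Fin 1 => if i.val + j.val + 1 = 1 then (1 : L) else 0)).Local v) ×
        (UnitaryGroup.cmDatum L 3 H').Local v => ((finKappaAt L v H' q.1 q.2 : ℤ) : ℂ))
      {q | IsLocalNormPair L H' v q.1 q.2 ∧ IsUnit ((finCharpolyTwo L v q.1).eval (finGammaTwo L v q.1))} :=
    (continuous_of_discreteTopology (f := fun n : ℤ => (n : ℂ))).comp_continuousOn (continuousOn_finKappaAt L v H' hH hdet)
  refine ((hτ.mul hD).mul hκ).congr fun q hq => ?_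
  exact finExplicitDelta_of_isLocalNormPair L v H' q.1 μ hq.1

end Head

end Literature.NumberTheory.Rogawski1990

end
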